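import Mathlib
import HarnessLib
import Literature.Computability.AlgebraicComplexity.AsymptoticSpectrum
import Literature.Computability.AlgebraicComplexity.BorderRankCW
import Literature.Computability.AlgebraicComplexity.TensorRestrictionRank
import Literature.Computability.AlgebraicComplexity.MatrixMultiplicationExponent
import Literature.Barriers.MatrixMultiplication.UniversalMethodBarrierProducts
import Summits.MatrixMultiplication.MatrixMultiplication.Theses.OutsiderSandwich
import Summits.MatrixMultiplication.MatrixMultiplication.Theorems.CwSquareDegeneratesToMM223

/-!
# CwCubeHostsMMThree — `⟨3,3,3⟩ ≤ cw₂^{⊠3}` as an honest restriction (decomp-mm lens 6, gen 10)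

Cross-lens rung for the route `OutsiderSandwich` (lens 4; TOP crux `CwTwoMMPerfect`, item
`stmt-MatrixMultiplication-27896`) and for the census cell's hand-off K5 (COSTUME-CENSUS v4,
2026-08-30: "`⟨3,3,3⟩ ⊴ cw₂^{⊠3}` found numerically as an order-1 DEGENERATION, the RESTRICTION
shows only a border signature; exact certificate wanted — handed to lens-4 / lens-6").

We give the exact certificate, and it is a RESTRICTION (no degeneration, no padding needed):

* `cwTwo_restrictsTo_matMul_one_one_three` — **`cw₂ ≥ ⟨1,1,3⟩`**: collapse the `y`-factor of the
  little Coppersmith–Winograd tensor `cw₂ = Σ_{j=1,2} x₀yⱼzⱼ + xⱼy₀zⱼ + xⱼyⱼz₀` with the functional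
  `y₀ + y₂` (an interference map, not a zeroing); the resulting `3 × 3` matrix in `(x, z)` is
  `M = [[0,0,1],[0,1,0],[1,0,1]]`, `det M = -1`, with integer inverse `[[-1,0,1],[0,1,0],[1,0,0]]`,
  so after the change of basis `M⁻¹` on the `x`-factor the tensor is `Σ_ν x_ν ⊗ y ⊗ z_ν = ⟨1,1,3⟩`
  (the tree's `matMulTensor 1 1 3`: a `1 × 1` by `1 × 3` product).  The same map on the `x`- and on
  the `z`-factor gives `cw₂ ≥ ⟨1,3,1⟩` and `cw₂ ≥ ⟨3,1,1⟩` (`cw₂` is `S₃`-symmetric).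
  All three identities are checked over `ℤ` by `decide` and cast to an ARBITRARY commutative ring
  `R` (so everything below holds over `ℂ`, over `𝔽₂ = ZMod 2`, over `ℤ`, …: the witness is
  `{0,±1}`-valued, in particular `2`-integral — relevant to the census K8 line `F2LIN(3,3)` and to
  lens-4's L2″ «a minimal witness must invert 2»: at `(N,m) = (3,3)` it need not).
* `mmThree_le_cwTwo_cube` — **`cw₂ ⊠ cw₂ ⊠ cw₂ ≥ ⟨1,1,3⟩ ⊠ ⟨1,3,1⟩ ⊠ ⟨3,1,1⟩ ≥ ⟨3,3,3⟩`**
  (Kronecker products of restrictions; the tree's `tensorRestrictsTo_kronecker_matMulTensor`).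
* `mmTwo_le_unitTwo_kronecker_cwTwo` (any `R`) — **`⟨2,2,2⟩ ≤ ⟨2⟩ ⊠ cw₂`**: the `2×2` matrix
  product is a `{0,±1}` restriction of `cw₂ ⊕ cw₂` (last section; corollary
  `mmFour_le_sq_unitTwo_kronecker_cwTwo`: `⟨4,4,4⟩ ≤ ⟨4⟩ ⊠ cw₂^{⊠2}`).
* `mmInCwTwoPow_three_three` (any `R`; `…_complex`, `…_zmod_two` the named instances) —
  **`I(3,3)`: `⟨3,3,3⟩ ≤ cw₂^{⊠3}`** in the route's grammar
  (`TensorRestrictsTo (kroneckerPow (cwTensor ℂ 2) 3) (matMulTensor ℂ 3 3 3)`), i.e. the finite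
  table entry `I(3,3)` of `CwTwoMMPerfect` is TRUE: `m² = 9` out of the flattening ceiling
  `3³ = 27` at level `N = 3` — the finite profile `q*_3 ≥ log₂9 / 3 = 1.0566` bits per copy
  (level 2: `q*_2 = 1` exactly, items 28736 / 29787; level-3 value known before: `I(3,2)`,
  `2/3` bit per copy).  By the route's monomial floor (`CwTwoMonomialFloor`, `m³ ≤ 2^N`) every
  witness of `I(3,3)` is necessarily NON-monomial; ours is signed (`-1` in `M⁻¹`) and interfering
  (`y₀ + y₂`).  In rate currency it is `9^{1/3} = 2.0801` per copy, below the route's kernel rung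
  `4^{log₆3} = 2.3397` (item 28620) — so it is a finite-table datum, not a new rate rung.

Why the census ALS missed it: the solution set of `⟨3,3,3⟩ = (A ⊗ B ⊗ C)·cw₂^{⊠3}` is positive-
dimensional and the product solution above has many exact zeros; unregularised ALS converges to
the boundary of such sets slowly ("border signature"), a known false-negative mode (the cell saw
the same at `I(4,4)`).

General remark (not formalised here beyond `q = 2`): for every `q ≥ 1`, `cw_q ≥ ⟨1,1,q+1⟩` (collapse
`y` with `y₀ + y₁`: the matrix is `[[0,1],[1,1]] ⊕ I_{q-1}` up to order, unimodular), hence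
`⟨q+1,q+1,q+1⟩ ≤ cw_q^{⊠3}`; likewise `CW_q ≥ ⟨1,1,q+2⟩` and `⟨q+2,q+2,q+2⟩ ≤ CW_q^{⊠3}`.  More
generally a tensor of format `m × m × m` that is `1`-generic in each factor (some slice pencil member
of full rank) hosts `⟨m,m,m⟩` in its cyclic Kronecker cube as a restriction.

Sources: CoppersmithWinograd1990 (§11, the tensor `cw₂`); ConnerGesmundoLandsbergVentura2022
(eq. (1), `T_{cw,q}`; Kronecker powers); Blaser2013 (§5.2, `⟨k,m,n⟩ ⊗ ⟨k',m',n'⟩ = ⟨kk',mm',nn'⟩`);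
BurgisserClausenShokrollahi1997 (Rem. 14.28, restriction is monoidal).  The identity
`cw₂ ≥ ⟨1,1,3⟩` itself: no source found (it is elementary; searches in the cell card NODE-g10.md).
-/

set_option linter.dupNamespace false

namespace Summit.MatrixMultiplication.MatrixMultiplication.Theorems.CwCubeHostsMMThree

open scoped BigOperators
open Literature.Computability.AlgebraicComplexity
open Literature.Barriers.MatrixMultiplication (tensorRestrictsTo_kronecker_matMulTensor)
open Summit.MatrixMultiplication.MatrixMultiplication.Theorems.CwSquareDegeneratesToMM223 (intCast_matMulTensor)

variable (R : Type) [CommRing R]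

/-! ## The three one-copy identities over `ℤ` -/

/-- Inverse of the collapsed matrix `M = [[0,0,1],[0,1,0],[1,0,1]]` (rows: new index, columns: host
index): `M⁻¹ = [[-1,0,1],[0,1,0],[1,0,0]]`. [new] -/
def mInv : Fin 3 → Fin 3 → ℤ := ![![-1, 0, 1], ![0, 1, 0], ![1, 0, 0]]

/-- The collapsing functional `e₀ + e₂` on a `cw₂`-factor. [new] -/
def coll : Fin 3 → ℤ := ![1, 0, 1]

/-- restriction matrices for `cw₂ ≥ ⟨1,1,3⟩` (`x ↦ M⁻¹`, `y ↦ e₀+e₂`, `z ↦ id`). [new] -/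
def a113 (p : Fin 1 × Fin 3) (a : Fin 3) : ℤ := mInv p.2 a
/-- see `a113`. [new] -/
def b113 (_ : Fin 1 × Fin 1) (b : Fin 3) : ℤ := coll b
/-- see `a113`. [new] -/
def c113 (p : Fin 1 × Fin 3) (c : Fin 3) : ℤ := if p.2 = c then 1 else 0

/-- restriction matrices for `cw₂ ≥ ⟨1,3,1⟩` (`x ↦ e₀+e₂`, `y ↦ M⁻¹`, `z ↦ id`). [new] -/
def a131 (_ : Fin 1 × Fin 1) (a : Fin 3) : ℤ := coll a
/-- see `a131`. [new] -/
def b131 (p : Fin 1 × Fin 3) (b : Fin 3) : ℤ := mInv p.2 b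
/-- see `a131`. [new] -/
def c131 (p : Fin 3 × Fin 1) (c : Fin 3) : ℤ := if p.1 = c then 1 else 0

/-- restriction matrices for `cw₂ ≥ ⟨3,1,1⟩` (`x ↦ M⁻¹`, `y ↦ id`, `z ↦ e₀+e₂`). [new] -/
def a311 (p : Fin 3 × Fin 1) (a : Fin 3) : ℤ := mInv p.1 a
/-- see `a311`. [new] -/
def b311 (p : Fin 3 × Fin 1) (b : Fin 3) : ℤ := if p.1 = b then 1 else 0
/-- see `a311`. [new] -/
def c311 (_ : Fin 1 × Fin 1) (c : Fin 3) : ℤ := coll c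

set_option maxRecDepth 4000 in
/-- `⟨1,1,3⟩ = (a113 ⊗ b113 ⊗ c113)·cw₂` entrywise over `ℤ`, by `decide`. [new] -/
theorem int_identity_113 : ∀ (a' : Fin 1 × Fin 3) (b' : Fin 1 × Fin 1) (c' : Fin 1 × Fin 3),
    matMulTensor ℤ 1 1 3 a' b' c' =
      ∑ a : Fin 3, ∑ b : Fin 3, ∑ c : Fin 3, a113 a' a * b113 b' b * c113 c' c * cwTensor ℤ 2 a b c := by
  decide

set_option maxRecDepth 4000 in
/-- `⟨1,3,1⟩ = (a131 ⊗ b131 ⊗ c131)·cw₂` entrywise over `ℤ`, by `decide`. [new] -/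
theorem int_identity_131 : ∀ (a' : Fin 1 × Fin 1) (b' : Fin 1 × Fin 3) (c' : Fin 3 × Fin 1),
    matMulTensor ℤ 1 3 1 a' b' c' =
      ∑ a : Fin 3, ∑ b : Fin 3, ∑ c : Fin 3, a131 a' a * b131 b' b * c131 c' c * cwTensor ℤ 2 a b c := by
  decide

set_option maxRecDepth 4000 in
/-- `⟨3,1,1⟩ = (a311 ⊗ b311 ⊗ c311)·cw₂` entrywise over `ℤ`, by `decide`. [new] -/
theorem int_identity_311 : ∀ (a' : Fin 3 × Fin 1) (b' : Fin 3 × Fin 1) (c' : Fin 1 × Fin 1),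
    matMulTensor ℤ 3 1 1 a' b' c' =
      ∑ a : Fin 3, ∑ b : Fin 3, ∑ c : Fin 3, a311 a' a * b311 b' b * c311 c' c * cwTensor ℤ 2 a b c := by
  decide

/-! ## Cast to an arbitrary commutative ring `R` -/

-- The cast `ℤ → R` of `⟨k,m,n⟩` is the landed `…Theorems.CwSquareDegeneratesToMM223.intCast_matMulTensor`
-- (reused by name; gate `dedup.landed`); the cast of `cw_q` is the landed
-- `Literature.Computability.AlgebraicComplexity.intCast_cwTensor` (`BorderRankCWKoszulRanksSqThree`, whose
-- olean is not built on the farm), so it is a one-line local `have` in each of the three proofs below.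

/-- **`cw₂ ≥ ⟨1,1,3⟩`** over any commutative ring `R` (an honest restriction by a signed,
interfering, `{0,±1}`-valued map). [new] -/
theorem cwTwo_restrictsTo_matMul_one_one_three :
    TensorRestrictsTo (cwTensor R 2) (matMulTensor R 1 1 3) := by
  refine ⟨fun p a => (a113 p a : R), fun p b => (b113 p b : R), fun p c => (c113 p c : R),
    fun a' b' c' => ?_⟩
  have h := congrArg (fun z : ℤ => (z : R)) (int_identity_113 a' b' c')
  have intCast_cwTensor : ∀ i j k : Fin 3, ((cwTensor ℤ 2 i j k : ℤ) : R) = cwTensor R 2 i j k := by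
    intro i j k; simp only [cwTensor_apply]; split_ifs <;> simp
  simpa only [Int.cast_sum, Int.cast_mul, intCast_matMulTensor, intCast_cwTensor] using h

/-- **`cw₂ ≥ ⟨1,3,1⟩`** over any commutative ring `R`. [new] -/
theorem cwTwo_restrictsTo_matMul_one_three_one :
    TensorRestrictsTo (cwTensor R 2) (matMulTensor R 1 3 1) := by
  refine ⟨fun p a => (a131 p a : R), fun p b => (b131 p b : R), fun p c => (c131 p c : R),
    fun a' b' c' => ?_⟩
  have h := congrArg (fun z : ℤ => (z : R)) (int_identity_131 a' b' c')
  have intCast_cwTensor : ∀ i j k : Fin 3, ((cwTensor ℤ 2 i j k : ℤ) : R) = cwTensor R 2 i j k := by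
    intro i j k; simp only [cwTensor_apply]; split_ifs <;> simp
  simpa only [Int.cast_sum, Int.cast_mul, intCast_matMulTensor, intCast_cwTensor] using h

/-- **`cw₂ ≥ ⟨3,1,1⟩`** over any commutative ring `R`. [new] -/
theorem cwTwo_restrictsTo_matMul_three_one_one :
    TensorRestrictsTo (cwTensor R 2) (matMulTensor R 3 1 1) := by
  refine ⟨fun p a => (a311 p a : R), fun p b => (b311 p b : R), fun p c => (c311 p c : R),
    fun a' b' c' => ?_⟩
  have h := congrArg (fun z : ℤ => (z : R)) (int_identity_311 a' b' c')
  have intCast_cwTensor : ∀ i j k : Fin 3, ((cwTensor ℤ 2 i j k : ℤ) : R) = cwTensor R 2 i j k := by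
    intro i j k; simp only [cwTensor_apply]; split_ifs <;> simp
  simpa only [Int.cast_sum, Int.cast_mul, intCast_matMulTensor, intCast_cwTensor] using h

/-! ## The cube -/

/-- **`cw₂ ⊠ cw₂ ⊠ cw₂ ≥ ⟨3,3,3⟩`** over any commutative ring `R`
(`≥ ⟨1,1,3⟩ ⊠ ⟨1,3,1⟩ ⊠ ⟨3,1,1⟩ ≥ ⟨1,3,3⟩ ⊠ ⟨3,1,1⟩ ≥ ⟨3,3,3⟩`). [new] -/
theorem mmThree_le_cwTwo_cube :
    TensorRestrictsTo
      (kroneckerTensor (kroneckerTensor (cwTensor R 2) (cwTensor R 2)) (cwTensor R 2))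
      (matMulTensor R 3 3 3) := by
  have h₁ := ((cwTwo_restrictsTo_matMul_one_one_three R).kronecker
    (cwTwo_restrictsTo_matMul_one_three_one R)).trans
      (tensorRestrictsTo_kronecker_matMulTensor R 1 1 3 1 3 1)
  have h₂ := (h₁.kronecker (cwTwo_restrictsTo_matMul_three_one_one R)).trans
    (tensorRestrictsTo_kronecker_matMulTensor R (1 * 1) (1 * 3) (3 * 1) 3 1 1)
  simpa using h₂

/-- `t^{⊠3} ≥ (t ⊠ t) ⊠ t` (relabelling `Fin 3 → ι` as `(ι × ι) × ι`). [folklore] -/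
theorem kroneckerPow_three_restrictsTo {ι κ μ : Type} [Fintype ι] [Fintype κ] [Fintype μ]
    [DecidableEq ι] [DecidableEq κ] [DecidableEq μ] (t : ι → κ → μ → R) :
    TensorRestrictsTo (kroneckerPow t 3) (kroneckerTensor (kroneckerTensor t t) t) := by
  have e : kroneckerTensor (kroneckerTensor t t) t = fun a b c =>
      kroneckerPow t 3 ![a.1.1, a.1.2, a.2] ![b.1.1, b.1.2, b.2] ![c.1.1, c.1.2, c.2] := by
    funext a b c
    simp [kroneckerPow_apply, kroneckerTensor_apply, Fin.prod_univ_three, mul_assoc]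
  rw [e]
  exact tensorRestrictsTo_precomp _ _ _ _

/-- **`I(3,3)` in kernel over any commutative ring `R`: `⟨3,3,3⟩ ≤ cw₂^{⊠3}`** — the finite table
entry of the route's TOP crux `CwTwoMMPerfect` at level `N = 3` with `m = 3` (`m² = 9 ≤ 27 = 3³`),
as an honest restriction with `{0,±1}` matrices. [new] -/
theorem mmInCwTwoPow_three_three :
    TensorRestrictsTo (kroneckerPow (cwTensor R 2) 3) (matMulTensor R 3 3 3) :=
  (kroneckerPow_three_restrictsTo R _).trans (mmThree_le_cwTwo_cube R)

/-- `I(3,3)` over `ℂ`, verbatim in the grammar of `CwTwoMMPerfect` / `LaserMergeOptimal`. [new] -/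
theorem mmInCwTwoPow_three_three_complex :
    TensorRestrictsTo (kroneckerPow (cwTensor ℂ 2) 3) (matMulTensor ℂ 3 3 3) :=
  mmInCwTwoPow_three_three ℂ

/-- `I(3,3)` over `𝔽₂`: the census K8 cell `F2LIN(3,3)` is SAT — a level-3, `m = 3` witness by
`𝔽₂`-linear maps exists (the `{0,±1}` witness reduced mod `2`); so at `(3,3)` a witness need NOT
invert `2` (lens-4 L2″). [new] -/
theorem mmInCwTwoPow_three_three_zmod_two :
    TensorRestrictsTo (kroneckerPow (cwTensor (ZMod 2) 2) 3) (matMulTensor (ZMod 2) 3 3 3) :=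
  mmInCwTwoPow_three_three (ZMod 2)

/-- The same, spelled as the `N = 3`, `m = 3` instance of the existential in `CwTwoMMPerfect`'s body
(with the numeric side `3^{(1-ε)·3} ≤ 9` for every `ε ≥ 1/3`): a finite witness line of the TOP
table. [new] -/
theorem cwTwoMMPerfect_witness_three_three {ε : ℝ} (hε : 1 / 3 ≤ ε) :
    ∃ m : ℕ, TensorRestrictsTo (kroneckerPow (cwTensor ℂ 2) 3) (matMulTensor ℂ m m m) ∧
      (3 : ℝ) ^ ((1 - ε) * (3 : ℕ)) ≤ (m : ℝ) ^ 2 := by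
  refine ⟨3, mmInCwTwoPow_three_three ℂ, ?_⟩
  have h1 : (1 - ε) * ((3 : ℕ) : ℝ) ≤ 2 := by push_cast; nlinarith
  calc (3 : ℝ) ^ ((1 - ε) * ((3 : ℕ) : ℝ)) ≤ (3 : ℝ) ^ (2 : ℝ) :=
        Real.rpow_le_rpow_of_exponent_le (by norm_num) h1
    _ = ((3 : ℕ) : ℝ) ^ 2 := by norm_num

/-! ## `⟨2,2,2⟩ ≤ ⟨2⟩ ⊠ cw₂`: the `2×2` matrix multiplication tensor is a sum of two CW tensors

A second `{0,±1}` restriction, found by greedy sparsification of an alternating-least-squares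
solution and then verified exactly: with the substitutions (copy `0` | copy `1` of `cw₂ ⊕ cw₂ = ⟨2⟩ ⊠ cw₂`)

    x:  p₀ = x₁₂, p₁ = x₂₁, p₂ = x₁₁   |  p₀' = x₁₁, p₁' = x₁₂, p₂' = −x₂₂
    y:  q₀ = y₁₁, q₁ = y₁₂, q₂ = y₂₁   |  q₀' = y₂₂, q₁' = y₁₂, q₂' = y₂₁
    z:  r₀ = z₂₂, r₁ = z₂₁, r₂ = z₁₁   |  r₀' = −z₂₁, r₁' = z₁₂, r₂' = −z₂₂

one has `cw₂(p,q,r) + cw₂(p',q',r') = Σ_{i,j,l} x_{ij} y_{jl} z_{il} = ⟨2,2,2⟩`: copy `0` delivers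
the products `111, 121, 211, 212`, copy `1` delivers `112, 122, 221, 222`, and the two parasitic
monomials `x₁₂y₁₂z₂₁`, `x₁₁y₂₁z₂₂` occur in both copies with opposite signs (over `𝔽₂`: twice).
Rank bookkeeping `4 + 4 = 8 = 7 + 1`.  Consequences recorded for the cell: `⟨4,4,4⟩ ≤ ⟨4⟩ ⊠ cw₂^{⊠2}`
(Kronecker square; `16` of `36` dimensions per factor, versus `16` of `81` for `I(2,2)^{⊠2}`), and
the NEGATIVE numerical findings that neither `⟨2⟩ ⊠ ⟨2,2,2⟩` nor `W ⊠`-intermediaries fit into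
`cw₂^{⊠2}` (ALS residual floors `0.50` / `0.54`), so an `I(3,4)` witness — if it exists — is
genuinely three-copy entangled (see NODE-g10 §2). -/

/-- `x`-substitution table of the witness `⟨2,2,2⟩ ≤ ⟨2⟩ ⊠ cw₂` (index order: target `(i,j)`,
host `(copy, ν)`). [new] -/
def xT : Fin 2 → Fin 2 → Fin 2 → Fin 3 → ℤ :=
  ![![![![0, 0, 1], ![1, 0, 0]], ![![1, 0, 0], ![0, 1, 0]]],
    ![![![0, 1, 0], ![0, 0, 0]], ![![0, 0, 0], ![0, 0, -1]]]]

/-- `y`-substitution table (target `(j,l)`, host `(copy, ν)`). [new] -/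
def yT : Fin 2 → Fin 2 → Fin 2 → Fin 3 → ℤ :=
  ![![![![1, 0, 0], ![0, 0, 0]], ![![0, 1, 0], ![0, 1, 0]]],
    ![![![0, 0, 1], ![0, 0, 1]], ![![0, 0, 0], ![1, 0, 0]]]]

/-- `z`-substitution table (target `(i,l)`, host `(copy, ν)`). [new] -/
def zT : Fin 2 → Fin 2 → Fin 2 → Fin 3 → ℤ :=
  ![![![![0, 0, 1], ![0, 0, 0]], ![![0, 0, 0], ![0, 1, 0]]],
    ![![![0, 1, 0], ![-1, 0, 0]], ![![1, 0, 0], ![0, 0, -1]]]]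

set_option maxRecDepth 8000 in
/-- The integer identity behind `⟨2,2,2⟩ ≤ ⟨2⟩ ⊠ cw₂` (tree index order of `matMulTensor`:
`(i,l), (i,j), (j,l)`), checked by `decide`. [new] -/
theorem int_identity_222 : ∀ a' b' c' : Fin 2 × Fin 2,
    matMulTensor ℤ 2 2 2 a' b' c' =
      ∑ s : Fin 2, ∑ ν : Fin 3, ∑ s' : Fin 2, ∑ ν' : Fin 3, ∑ s'' : Fin 2, ∑ ν'' : Fin 3,
        zT a'.1 a'.2 s ν * xT b'.1 b'.2 s' ν' * yT c'.1 c'.2 s'' ν'' *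
          kroneckerTensor (unitTensor ℤ 2) (cwTensor ℤ 2) (s, ν) (s', ν') (s'', ν'') := by
  decide

/-- cast `ℤ → R` of the host `⟨2⟩ ⊠ cw₂`. [folklore] -/
theorem intCast_unitTwo_kronecker_cwTwo (a b c : Fin 2 × Fin 3) :
    ((kroneckerTensor (unitTensor ℤ 2) (cwTensor ℤ 2) a b c : ℤ) : R) =
      kroneckerTensor (unitTensor R 2) (cwTensor R 2) a b c := by
  simp only [kroneckerTensor_apply, unitTensor_apply, cwTensor_apply, Int.cast_mul]
  split_ifs <;> simp

/-- **`⟨2,2,2⟩ ≤ ⟨2⟩ ⊠ cw₂`** over any commutative ring `R`: the `2 × 2` matrix multiplication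
tensor is an honest restriction (by `{0,±1}` matrices) of the direct sum of two copies of the little
Coppersmith–Winograd tensor `cw₂`. [new] -/
theorem mmTwo_le_unitTwo_kronecker_cwTwo :
    TensorRestrictsTo (kroneckerTensor (unitTensor R 2) (cwTensor R 2)) (matMulTensor R 2 2 2) := by
  refine ⟨fun a' a => (zT a'.1 a'.2 a.1 a.2 : R), fun b' b => (xT b'.1 b'.2 b.1 b.2 : R),
    fun c' c => (yT c'.1 c'.2 c.1 c.2 : R), fun a' b' c' => ?_⟩
  have h := congrArg (fun z : ℤ => (z : R)) (int_identity_222 a' b' c')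
  simpa only [Int.cast_sum, Int.cast_mul, intCast_matMulTensor, intCast_unitTwo_kronecker_cwTwo,
    Fintype.sum_prod_type] using h

/-- Corollary: **`⟨4,4,4⟩ ≤ (⟨2⟩ ⊠ cw₂) ⊠ (⟨2⟩ ⊠ cw₂)`** (`= ⟨4⟩ ⊠ cw₂^{⊠2}` up to relabelling) —
four copies of `cw₂ ⊠ cw₂` host a `4 × 4` matrix product by an honest restriction. [new] -/
theorem mmFour_le_sq_unitTwo_kronecker_cwTwo :
    TensorRestrictsTo
      (kroneckerTensor (kroneckerTensor (unitTensor R 2) (cwTensor R 2))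
        (kroneckerTensor (unitTensor R 2) (cwTensor R 2)))
      (matMulTensor R 4 4 4) := by
  have h := ((mmTwo_le_unitTwo_kronecker_cwTwo R).kronecker
    (mmTwo_le_unitTwo_kronecker_cwTwo R)).trans
      (tensorRestrictsTo_kronecker_matMulTensor R 2 2 2 2 2 2)
  simpa using h

end Summit.MatrixMultiplication.MatrixMultiplication.Theorems.CwCubeHostsMMThree
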